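import Mathlib
import Literature.MathematicalPhysics.QuantumLattice.DWaveSource
import Literature.MathematicalPhysics.QuantumLattice.XYOrder
import Literature.MathematicalPhysics.QuantumLattice.HubbardScaleReportCT
import Literature.MathematicalPhysics.QuantumLattice.SymmetricRegimeCertificateT
import HarnessLib

/-!
# AnomalousBlockFloorHyp

Topic `Literature/MathematicalPhysics/QuantumLattice`. Named literature fact(s) relocated by the gate from `Summits/HubbardSuperconductivity/HubbardSuperconductivity/Theorems/SeededBrokenRegimeBoseFermiPinned/Negative/SeededBrokenRegimeBoseFermiPinnedFalseOfAnomalousBlockFloorHyp.lean`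
(accept-time relocation of `[cite]`d propositions written inline in a Summits proposal; human ruling 2026-08-15).

* `Literature.MathematicalPhysics.QuantumLattice.AnomalousBlockFloorHyp`
-/

namespace Literature.MathematicalPhysics.QuantumLattice

/-- **`AnomalousBlockFloorHyp`** — a positive remainder floor carried by the certified points of the box: there is `c > 0`
such that for every symmetric tolerance `Θ` some `(U, δ, μ)` with `U ∈ [2,3]`, `δ ∈ [1/5, 7/20]`, ground-state density
`→ 1 - δ`, and a `v3` certificate `symmetricRegimeCertificateT U μ capRgCornerDataT Θ K Λ L₀`, has the datum-level floor:
for seeds below some `h₁ > 0`, every scale datum with `0 < numPatches` that is certified against `hubbardScaleReportCT U μ D h`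
for all `h ∈ (0, h₀]`, `h₀ ≤ h₁`, satisfies `c ≤ D.remainderNorm.snd` or meets the unit-stiffness thresholds for no remainder
budget.  (Expected for the report D1″ — anomalous `B₁g` block unkept and marginal — but not constructible here: it contains a
certified point and a model floor.) [folklore] [topic MathematicalPhysics/QuantumLattice] -/
def AnomalousBlockFloorHyp : Prop :=
  ∃ c : ℝ, 0 < c ∧ ∀ Θ : Literature.MathematicalPhysics.QuantumLattice.SymmetricTolerance,
    ∃ U ∈ Set.Icc (2:ℝ) 3, ∃ δ ∈ Set.Icc (1/5:ℝ) (7/20), ∃ μ : ℝ,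
      Filter.Tendsto (fun L : ℕ =>
          ((Literature.MathematicalPhysics.QuantumLattice.hubbardTorusWith 2 (L + 1) 1 U μ).groundStateFunctional
              Literature.MathematicalPhysics.QuantumLattice.totalNumber).re / ((L + 1 : ℕ) : ℝ) ^ 2)
        Filter.atTop (nhds (1 - δ)) ∧
      (∃ (K : Literature.MathematicalPhysics.QuantumLattice.TrigPolyC4v) (Λ : ℝ) (L₀ : ℕ),
        Literature.MathematicalPhysics.QuantumLattice.symmetricRegimeCertificateT U μ
          Literature.MathematicalPhysics.QuantumLattice.capRgCornerDataT Θ K Λ L₀) ∧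
      ∃ h₁ : ℝ, 0 < h₁ ∧ ∀ (D : Literature.MathematicalPhysics.QuantumLattice.HubbardScaleData) (h₀ : ℝ),
        0 < h₀ → h₀ ≤ h₁ → 0 < D.numPatches →
          (∀ h ∈ Set.Ioc (0:ℝ) h₀, ∃ L₀' : ℕ,
            D.IsCertifiedEnclosure (Literature.MathematicalPhysics.QuantumLattice.hubbardScaleReportCT U μ D h) L₀') →
          c ≤ ((D.remainderNorm.snd : ℚ) : ℝ) ∨ ∀ η : ℚ, ¬ D.MeetsThresholds 1 η

end Literature.MathematicalPhysics.QuantumLattice
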